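import Literature.Probability.RandomPlanarGeometry.HexSAWBrickWallSpanRenewal
import Literature.Probability.RandomPlanarGeometry.HexSAWBrickWallBridgeLimit
import Literature.Probability.RandomPlanarGeometry.HexSAWHammersleyWelshExplicit
import HarnessLib

/-!
# `b_n(ℍ) μ_ℍ^{-n} → 0` for the brick-wall (perpendicular-frame) bridges, from Beaton's Theorem 14 (named fact)

Topic `Literature/Probability/RandomPlanarGeometry` (continues `HexSAWBrickWallSpanRenewal.lean` (the span renewal
sequence `v_T`, `f_T` of brick-wall bridges at `1/μ_ℍ`: `bwSpanV`, `bwSpanF`, `v_0 = 1`, `v_T = Σ f_k v_{T-k}`, `v_T ≤ 1`,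
`Σ_T f_T = 1`) and `HexSAWBrickWallBridgeLimit.lean` (door R87b: `b_N(ℍ)/μ_ℍ^N → L` with
`tendsto_bridgeCount_div_pow_zero_of_not_summable : E(length of a critical irreducible bridge) = ∞ ⇒ L = 0`, and the
sentence "Whether `L = 0` in this frame is not decided here")).  Lane «pcv-sawmu», door R93 (a) «HEX-BW-BRIDGE-NULL»
(planner a-idea-1 g14/g15, ROUTES-G14 ed.8 §R93, faces K93.3–K93.4).

Source of the INPUT: N. R. Beaton, *The critical surface fugacity of self-avoiding walks on a rotated honeycomb lattice*,
J. Phys. A 47 (2014) 075003 (arXiv:1210.0274), Appendix.  Printed setting (arXiv:1210.0274v3 PDF p. 19; the printed appendix is unlabelled: «Appendix»): "we orient the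
honeycomb lattice so that it contains horizontal edges … The lattice has an origin in `ℍ`, which we will fix to lie on a
positive mid-edge `a_0` … we define a PP-bridge `γ` to be a SAW which starts and ends on positive mid-edges and satisfies
`y(γ_0) < y(γ_i) < y(γ_n)` for `0 < i < n` … The height `H(γ)` of a PP-bridge `γ` is the length of the shortest PP-bridge
`γ'` satisfying `y(γ_0) = y(γ'_0)` and `y(γ_n) = y(γ'_n)`."  **Theorem 14**: "Let `PP_T(x) := Σ_{n≥0} Σ_{γ ∈ SAPP_n, H(γ)=T} x^n`
… Then `lim_{T→∞} PP_T(x_c) = 0`, where `x_c = 1/√(2+√2)`."  Lemma 16 (arXiv v3 p. 20): "`PP_T(x_c) → 1/E_iSAPP(H(γ))`" and "Thus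
Theorem 14 is equivalent to `E_iSAPP(H(γ)) = ∞`"; display before Lemma 16: Kesten's relation "`Σ_{γ ∈ iSAPP} x_c^{|γ|} = 1`".
The printed PROOF of Theorem 14 (the "stickbreak" argument, arXiv v3 pp. 20–27, after Duminil-Copin–Hammond) is NOT formalised:
**everything in this file that depends on it is CONDITIONAL on the named fact `Beaton2014Thm14`**, typed below AS PRINTED
in the tree's brick-wall coordinates (see `ppWalks` for the three-line dictionary).  The corollary
`b_n(ℍ) μ_ℍ^{-n} → 0` for bridges crossing ℍ PERPENDICULARLY to an edge class is not stated in print; the parallel-frame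
statement (Duminil-Copin–Smirnov strips) is the tree's `SAW.hexBridgeLengthNull` family (a-idea-1/a-p5, R87-Q).

## The dictionary (Beaton's rotated honeycomb ↔ the tree's brick wall)

The brick wall `brickWallGraph` (horizontal bonds everywhere, the vertical bond `{(x,y),(x,y+1)}` present iff `x+y` is
even) is the honeycomb lattice; its vertical bonds are ONE edge class of `ℍ` — Beaton's horizontal edges — and the
brick-wall coordinate `0` is Beaton's vertical direction `y` (one horizontal brick-wall bond = one tilted honeycomb
edge = `√3/2` in `y`, so Beaton's `H = (2/√3)·y` is measured in brick-wall height units).  The two tilted edge classes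
("positive" = SW/NE, "negative") are the horizontal bonds `{(x,y),(x+1,y)}` with `x+y` odd, resp. even (a convention;
the glide `(x,y) ↦ (x+1,-y)` exchanges the two and preserves every count below).  With `a_0 = {(-1,0),(0,0)}` (positive),
a PP-bridge of mid-edge length `m ≥ 1` from `a_0` is the same thing as a vertex walk `ω(0..n)`, `n = m - 1`, of the brick
wall from `(0,0)` (`HexBW.saws n`) such that: (i) `0 = ω₀(0) ≤ ω₀(i) ≤ ω₀(n)` for all `i` (the strict inequalities
between MID-EDGE heights `y(γ_0) = -½ < y(γ_i) < y(γ_m) = ω₀(n) + ½` are exactly the weak inequalities between VERTEX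
heights), (ii) `n` is ODD (the last vertex `ω(n)` has parity `n`, and its positive half-edge points UP in height iff
`ω(n)` is odd), with `|γ| = m = n + 1` ("the total length of a walk is the same as the number of vertices it occupies",
p. 5) and `H(γ) = ω₀(n) + 1` (the straight PP-bridge to that height has `ω₀(n) + 1` vertices).  The empty PP-bridge
(`m = 0`, `H = 0`) only affects `PP_0` and is omitted.

## Contents (namespace `Literature.Probability.RandomPlanarGeometry.SAW.HexBW`)

* `ppWalks T n`, `ppCount T n`, `ppTerm T n = ppCount T n · x_c^{n+1}`, **`beatonPP T = PP_T(x_c)`**, and the NAMED FACT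
  **`Beaton2014Thm14 : Prop := Tendsto beatonPP atTop (𝓝 0)`** (unproved here; hypothesis of the results below);
* the DICTIONARY LEMMAS (proved): `ppCount_le_card_spanBridges : ppCount T n ≤ #spanBridges (n+1) T` (prepend a step:
  tree `HexBW.prep`), `card_spanBridges_le_ppCount` (odd `n`: a Madras–Slade bridge of span `T` IS a PP object of height
  `T+1`), `card_spanBridges_le_succ` (append a horizontal step), `summable_ppTerm`,
  **`bwSpanV_le_beatonPP : v_T ≤ μ_ℍ · PP_{T+1}(x_c) + μ_ℍ² · PP_{T+2}(x_c)`**;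
* K93.4 + assembly (conditional on the named fact): `tendsto_bwSpanV_zero_of_beaton`,
  `not_summable_mul_bwSpanF_of_beaton` (infinite mean SPAN — Beaton's `E_iSAPP(H) = ∞` in brick-wall dress, via Feller's
  null-recurrence criterion `Renewal.not_summable_mul_of_tendsto_zero` exactly as `HV.not_summable_width_mul_stripIlim`
  does in the parallel frame), `not_summable_mul_irreducibleBridgeCount_of_beaton` (infinite mean LENGTH, K93.0), and
  **`tendsto_bridgeCount_div_pow_zero_of_beaton : Beaton2014Thm14 → b_n(ℍ) μ_ℍ^{-n} → 0`** (the target of door R93);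
* Beaton's Lemma 16 as THEOREMS (unconditional): `bwSpanF_one_pos`, `tendsto_bwSpanV_zero_iff_not_summable`,
  `beaton2014Thm14_iff_tendsto_bwSpanV_zero`, **`beaton2014Thm14_iff_not_summable : Beaton2014Thm14 ↔ ¬ Summable (T ↦ T f_T)`**
  — the named fact is equivalent to the infinite mean span of the tree's critical irreducible brick-wall bridges.
-/

noncomputable section

open Finset Filter Topology Function Literature.Probability.LatticeModels Literature.Probability.Percolation
  SimpleGraph
open scoped BigOperators

namespace Literature.Probability.RandomPlanarGeometry.SAW

namespace HexBW

/-! ### Beaton's PP-bridges in brick-wall coordinates and the named fact -/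

open Classical in
/-- **Beaton's PP-bridges from `a_0` of height `T` and mid-edge length `n + 1`, in brick-wall coordinates**: for ODD `n`,
the `n`-step brick-wall walks `ω` from the origin with `0 ≤ ω₀(i) ≤ ω₀(n)` for all `i ≤ n` and `ω₀(n) + 1 = T`; for even
`n`, none.  Dictionary (module docstring): PP-bridge = "SAW which starts and ends on positive mid-edges and satisfies
`y(γ_0) < y(γ_i) < y(γ_n)` for `0 < i < n`" read through (i) strict mid-edge heights ⟺ weak vertex heights, (ii) positive
exit half-edge pointing up ⟺ odd end vertex ⟺ `n` odd, (iii) `|γ| = n + 1`, `H(γ) = (2/√3)·y(γ_{|γ|}) = ω₀(n) + 1`.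
Beaton defines `H(γ)` on p. 19 (arXiv v3) as the length of the shortest PP-bridge with the same end heights and on p. 20 uses
`H(γ) = (2/√3)·y(γ_n)`; the two differ by one when `(2/√3)·y(γ_n)` is odd (straight climbs alternate positive and
negative mid-edges); we follow the p. 20 formula — the one used in the proof, additive under concatenation — and
Theorem 14 is equivalent under both readings (`PP^{(p.15)}_T = PP^{(p.16)}_T + PP^{(p.16)}_{T-1}` for even `T`, `= 0` for
odd `T`, all terms nonnegative) [lit-1 g9 as-printed audit, 2026-08-23].
[cite: Beaton2014RotatedHoneycomb, Appendix (definition of PP-bridges and of the height H, arXiv v3 p. 19; "H(γ) = (2/√3) y(γ_n)", arXiv v3 p. 20)] -/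
def ppWalks (T n : ℕ) : Finset (ℕ → Site 2) :=
  if Odd n then (saws n).filter fun ω => (∀ i ≤ n, 0 ≤ ω i 0 ∧ ω i 0 ≤ ω n 0) ∧ ω n 0 + 1 = (T : ℤ) else ∅

/-- The number of PP-bridges from `a_0` of height `T` and length `n + 1`. [cite: Beaton2014RotatedHoneycomb, Appendix, Theorem 14 (arXiv v3 p. 19)] -/
def ppCount (T n : ℕ) : ℕ := #(ppWalks T n)

/-- The terms `ppCount T n · x_c^{n+1}` of `PP_T(x_c)` (`x_c = hexCriticalFugacity = 1/√(2+√2)`).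
[cite: Beaton2014RotatedHoneycomb, Appendix, Theorem 14 (arXiv v3 p. 19)] -/
def ppTerm (T n : ℕ) : ℝ := (ppCount T n : ℝ) * hexCriticalFugacity ^ (n + 1)

/-- **`PP_T(x_c) = Σ_{n≥0} Σ_{γ ∈ SAPP_n, H(γ)=T} x_c^n`**, Beaton's generating function of PP-bridges of height `T` at the
critical fugacity, in brick-wall coordinates (indexed by the vertex length `n = |γ| - 1`; the empty PP-bridge is omitted).
[cite: Beaton2014RotatedHoneycomb, Appendix, Theorem 14 (arXiv v3 p. 19)] -/
def beatonPP (T : ℕ) : ℝ := ∑' n : ℕ, ppTerm T n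

/-- **Beaton 2014, Theorem 14** (NAMED FACT, not proved here): "`lim_{T→∞} PP_T(x_c) = 0`, where `x_c = 1/√(2+√2)`" —
the generating function of PP-bridges of height `T` of the honeycomb lattice oriented with horizontal edges (bridges
crossing PERPENDICULARLY to an edge class), at the critical fugacity, tends to zero as `T → ∞`.  Printed proof: the
stickbreak argument of Appendix (after Beaton–Bousquet-Mélou–de Gier–Duminil-Copin–Guttmann and Duminil-Copin–Hammond),
not formalised.  Equivalent in print (Lemma 16) to `E_iSAPP(H(γ)) = ∞`.
[cite: Beaton2014RotatedHoneycomb, Appendix, Theorem 14 (arXiv v3 p. 19); Lemma 16 (arXiv v3 p. 20)] -/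
def Beaton2014Thm14 : Prop := Tendsto beatonPP atTop (𝓝 0)

/-- Membership in `ppWalks` (odd length). [cite: Beaton2014RotatedHoneycomb, Appendix (arXiv v3 p. 19)] -/
theorem mem_ppWalks {T n : ℕ} (hn : Odd n) {ω : ℕ → Site 2} :
    ω ∈ ppWalks T n ↔ ω ∈ saws n ∧ (∀ i ≤ n, 0 ≤ ω i 0 ∧ ω i 0 ≤ ω n 0) ∧ ω n 0 + 1 = (T : ℤ) := by
  classical
  rw [ppWalks, if_pos hn, Finset.mem_filter]

/-- `ppWalks T n = ∅` for even `n`. [cite: Beaton2014RotatedHoneycomb, Appendix (arXiv v3 p. 19)] -/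
theorem ppWalks_of_even {T n : ℕ} (hn : ¬ Odd n) : ppWalks T n = ∅ := by
  rw [ppWalks, if_neg hn]

/-- `0 ≤ ppTerm T n`. [cite: Beaton2014RotatedHoneycomb, Appendix, Theorem 14] -/
theorem ppTerm_nonneg (T n : ℕ) : 0 ≤ ppTerm T n :=
  mul_nonneg (Nat.cast_nonneg _) (pow_nonneg hexCriticalFugacity_pos_lt_one.1.le _)

/-- `x_c^k = (μ_ℍ^k)⁻¹`. [cite: DuminilCopinSmirnov2012, Thm 1] -/
theorem hexCriticalFugacity_pow (k : ℕ) : hexCriticalFugacity ^ k = (hexConnectiveConstant ^ k)⁻¹ := by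
  rw [hexConnectiveConstant_eq_inv, inv_pow, inv_inv]

/-! ### The dictionary lemmas -/

/-- **PP objects are one prepended step away from Madras–Slade bridges**: `ppCount T n ≤ #spanBridges (n+1) T` — the
tree's `HexBW.prep` (a horizontal step prepended to a weak bridge gives a bridge) is injective and raises the endpoint
height by one, so a PP object of height `T = ω₀(n) + 1` becomes an `(n+1)`-step bridge of span `T`.
[cite: Beaton2014RotatedHoneycomb, Appendix (arXiv v3 p. 19); MadrasSlade1993, §3.1 (proof of Theorem 3.1.1)] -/
theorem ppCount_le_card_spanBridges (T n : ℕ) : ppCount T n ≤ #(spanBridges (n + 1) T) := by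
  rw [ppCount]
  by_cases hn : Odd n
  · refine Finset.card_le_card_of_injOn prep (fun ω hω => ?_) (fun ω _ ω' _ h => prep_injective h)
    rw [Finset.mem_coe, mem_ppWalks hn] at hω
    obtain ⟨hω, hweak, hT⟩ := hω
    have h00 : ω 0 0 = 0 := by rw [(mem_saws_iff.1 hω).1]; rfl
    rw [Finset.mem_coe, mem_spanBridges]
    refine ⟨prep_mem_bridges hω (fun i hi => by rw [h00]; exact (hweak i hi).1) (fun i hi => (hweak i hi).2), ?_⟩
    rw [prep_succ_apply_zero, hT]
  · rw [ppWalks_of_even hn, Finset.card_empty]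
    exact Nat.zero_le _

/-- **A Madras–Slade brick-wall bridge of odd length and span `T` IS a PP object of height `T + 1`**:
`#spanBridges n T ≤ ppCount (T+1) n` for odd `n` (the inclusion `spanBridges n T ⊆ ppWalks (T+1) n`).
[cite: Beaton2014RotatedHoneycomb, Appendix (arXiv v3 p. 19); MadrasSlade1993, §1.2, Definition 1.2.4] -/
theorem card_spanBridges_le_ppCount {n : ℕ} (hn : Odd n) (T : ℕ) : #(spanBridges n T) ≤ ppCount (T + 1) n := by
  rw [ppCount]
  refine Finset.card_le_card fun ω hω => ?_
  obtain ⟨hb, hT⟩ := mem_spanBridges.1 hω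
  obtain ⟨hS, hbr⟩ := mem_bridges.1 hb
  have h00 : ω 0 0 = 0 := by rw [(mem_saws_iff.1 hS).1]; rfl
  refine (mem_ppWalks hn).2 ⟨hS, fun i hi => ?_, by rw [hT]; push_cast; ring⟩
  rcases Nat.eq_zero_or_pos i with rfl | hipos
  · rw [h00, hT]; exact ⟨le_rfl, by exact_mod_cast Nat.zero_le T⟩
  · have h := hbr i hipos hi
    rw [h00] at h
    exact ⟨h.1.le, h.2⟩

/-- **Appending one horizontal step**: `#spanBridges n T ≤ #spanBridges (n+1) (T+1)` — the twisted gluing with the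
one-step straight bridge (`HexBW.concat n ω (straightWalk 1)`) is injective and raises length and span by one.
[cite: MadrasSlade1993, §1.2, eq. (1.2.15)] -/
theorem card_spanBridges_le_succ (n T : ℕ) : #(spanBridges n T) ≤ #(spanBridges (n + 1) (T + 1)) := by
  refine Finset.card_le_card_of_injOn (fun ω => concat n ω (Zd.straightWalk 2 1)) (fun ω hω => ?_) ?_
  · rw [Finset.mem_coe, mem_spanBridges] at hω ⊢
    obtain ⟨hb, hT⟩ := hω
    refine ⟨concat_mem_bridges hb (straightWalk_mem_bridges 1), ?_⟩
    have h0 : Zd.straightWalk 2 1 0 = 0 := by simp [Zd.straightWalk]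
    show concat n ω (Zd.straightWalk 2 1) (n + 1) 0 = ((T + 1 : ℕ) : ℤ)
    rw [concat_apply_add_zero n ω (Zd.straightWalk 2 1) h0 1, hT]
    simp [Zd.straightWalk]
  · intro ω hω ω' hω' h
    rw [Finset.mem_coe, mem_spanBridges] at hω hω'
    obtain ⟨_, hend, -, -⟩ := Zd.mem_saws.1 (Zd.mem_bridges.1 (bridges_subset_zd n hω.1)).1
    obtain ⟨_, hend', -, -⟩ := Zd.mem_saws.1 (Zd.mem_bridges.1 (bridges_subset_zd n hω'.1)).1
    funext i
    rcases le_or_gt i n with hi | hi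
    · have := congrFun h i
      simpa [concat, Zd.concatWalk, hi] using this
    · rw [hend i hi.le, hend' i hi.le]
      have := congrFun h n
      simpa [concat, Zd.concatWalk] using this

/-- The terms of `PP_T(x_c)` are dominated by the (shifted) terms of `v_T`: `ppTerm T n ≤ bwSpanTerm T (n+1)`.
[cite: Beaton2014RotatedHoneycomb, Appendix (arXiv v3 p. 19)] -/
theorem ppTerm_le_bwSpanTerm (T n : ℕ) : ppTerm T n ≤ bwSpanTerm T (n + 1) := by
  unfold ppTerm bwSpanTerm
  rw [hexCriticalFugacity_pow, div_eq_mul_inv]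
  exact mul_le_mul_of_nonneg_right (by exact_mod_cast ppCount_le_card_spanBridges T n)
    (inv_nonneg.2 (pow_nonneg hexConnectiveConstant_pos.le _))

/-- **`PP_T(x_c)` is finite** (summable), for every `T` — dominated by `v_T ≤ 1` through the prepended step.
[cite: Beaton2014RotatedHoneycomb, Appendix, Theorem 14 (arXiv v3 p. 19)] -/
theorem summable_ppTerm (T : ℕ) : Summable (ppTerm T) :=
  Summable.of_nonneg_of_le (ppTerm_nonneg T) (ppTerm_le_bwSpanTerm T)
    ((summable_bwSpanTerm T).comp_injective (add_left_injective 1))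

/-- `0 ≤ PP_T(x_c)`. [cite: Beaton2014RotatedHoneycomb, Appendix, Theorem 14] -/
theorem beatonPP_nonneg (T : ℕ) : 0 ≤ beatonPP T := tsum_nonneg (ppTerm_nonneg T)

/-- `PP_T(x_c) ≤ v_T ≤ 1`. [cite: Beaton2014RotatedHoneycomb, Appendix, Theorem 14] -/
theorem beatonPP_le_bwSpanV (T : ℕ) : beatonPP T ≤ bwSpanV T := by
  unfold beatonPP bwSpanV
  calc ∑' n, ppTerm T n ≤ ∑' n, bwSpanTerm T (n + 1) :=
        (summable_ppTerm T).tsum_le_tsum (ppTerm_le_bwSpanTerm T)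
          ((summable_bwSpanTerm T).comp_injective (add_left_injective 1))
    _ ≤ ∑' n, bwSpanTerm T n := by
        rw [(summable_bwSpanTerm T).tsum_eq_zero_add]
        linarith [bwSpanTerm_nonneg T 0]

/-- The termwise sandwich: `bwSpanTerm T n ≤ μ_ℍ · ppTerm (T+1) n + μ_ℍ² · ppTerm (T+2) (n+1)` (odd `n`: the bridge is a
PP object of height `T+1`; even `n`: append a step, then it is a PP object of height `T+2`).
[cite: Beaton2014RotatedHoneycomb, Appendix (arXiv v3 p. 19); MadrasSlade1993, §1.2] -/
theorem bwSpanTerm_le_ppTerm (T n : ℕ) :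
    bwSpanTerm T n ≤ hexConnectiveConstant * ppTerm (T + 1) n + hexConnectiveConstant ^ 2 * ppTerm (T + 2) (n + 1) := by
  have hμ : 0 < hexConnectiveConstant := hexConnectiveConstant_pos
  have hμn : 0 < hexConnectiveConstant ^ n := pow_pos hμ n
  -- rewrite the two PP terms over `μ^{-n}`
  have e1 : hexConnectiveConstant * ppTerm (T + 1) n = (ppCount (T + 1) n : ℝ) / hexConnectiveConstant ^ n := by
    unfold ppTerm
    rw [hexCriticalFugacity_pow, pow_succ]
    field_simp
  have e2 : hexConnectiveConstant ^ 2 * ppTerm (T + 2) (n + 1) =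
      (ppCount (T + 2) (n + 1) : ℝ) / hexConnectiveConstant ^ n := by
    unfold ppTerm
    rw [hexCriticalFugacity_pow, show n + 1 + 1 = n + 2 by ring, pow_add]
    field_simp
  rw [e1, e2, ← add_div]
  unfold bwSpanTerm
  refine div_le_div_of_nonneg_right ?_ hμn.le
  by_cases hn : Odd n
  · have h1 : (#(spanBridges n T) : ℝ) ≤ ppCount (T + 1) n := by exact_mod_cast card_spanBridges_le_ppCount hn T
    have h2 : (0 : ℝ) ≤ ppCount (T + 2) (n + 1) := Nat.cast_nonneg _
    linarith
  · have hn1 : Odd (n + 1) := by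
      rcases Nat.even_or_odd n with h | h
      · exact h.add_one
      · exact absurd h hn
    have h1 : (#(spanBridges n T) : ℝ) ≤ ppCount (T + 2) (n + 1) := by
      exact_mod_cast (card_spanBridges_le_succ n T).trans (card_spanBridges_le_ppCount hn1 (T + 1))
    have h2 : (0 : ℝ) ≤ ppCount (T + 1) n := Nat.cast_nonneg _
    linarith

/-- **The sandwich `v_T ≤ μ_ℍ · PP_{T+1}(x_c) + μ_ℍ² · PP_{T+2}(x_c)`** (the converse half `PP_T ≤ v_T` is
`beatonPP_le_bwSpanV`): Beaton's height-`T` generating functions and the span-`T` generating functions of the tree's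
Madras–Slade brick-wall bridges tend to zero together. [cite: Beaton2014RotatedHoneycomb, Appendix, Theorem 14 and Corollary 15 (arXiv v3 pp. 19–20: the analogous sandwich "2 PP_T ≤ B_T ≤ (2/x_c) PP_T")] -/
theorem bwSpanV_le_beatonPP (T : ℕ) :
    bwSpanV T ≤ hexConnectiveConstant * beatonPP (T + 1) + hexConnectiveConstant ^ 2 * beatonPP (T + 2) := by
  have hμ : 0 ≤ hexConnectiveConstant := hexConnectiveConstant_pos.le
  have hs1 : Summable fun n => hexConnectiveConstant * ppTerm (T + 1) n := (summable_ppTerm (T + 1)).mul_left _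
  have hs2' : Summable fun n => ppTerm (T + 2) (n + 1) :=
    (summable_ppTerm (T + 2)).comp_injective (add_left_injective 1)
  have hs2 : Summable fun n => hexConnectiveConstant ^ 2 * ppTerm (T + 2) (n + 1) := hs2'.mul_left _
  unfold bwSpanV
  calc ∑' n, bwSpanTerm T n
      ≤ ∑' n, (hexConnectiveConstant * ppTerm (T + 1) n + hexConnectiveConstant ^ 2 * ppTerm (T + 2) (n + 1)) :=
        (summable_bwSpanTerm T).tsum_le_tsum (bwSpanTerm_le_ppTerm T) (hs1.add hs2)
    _ = hexConnectiveConstant * beatonPP (T + 1) + hexConnectiveConstant ^ 2 * ∑' n, ppTerm (T + 2) (n + 1) := by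
        rw [hs1.tsum_add hs2, tsum_mul_left, tsum_mul_left]
        rfl
    _ ≤ hexConnectiveConstant * beatonPP (T + 1) + hexConnectiveConstant ^ 2 * beatonPP (T + 2) := by
        have h : ∑' n, ppTerm (T + 2) (n + 1) ≤ beatonPP (T + 2) := by
          unfold beatonPP
          rw [(summable_ppTerm (T + 2)).tsum_eq_zero_add]
          linarith [ppTerm_nonneg (T + 2) 0]
        nlinarith [h, pow_nonneg hμ 2]

/-! ### K93.4 and the assembly: conditional consequences of Beaton's Theorem 14 -/

/-- Beaton's Theorem 14 transported: **the span generating functions of the tree's brick-wall bridges tend to zero**,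
`v_T → 0`. [cite: Beaton2014RotatedHoneycomb, Appendix, Theorem 14 and Corollary 15 (arXiv v3 p. 19)] -/
theorem tendsto_bwSpanV_zero_of_beaton (h : Beaton2014Thm14) : Tendsto bwSpanV atTop (𝓝 0) := by
  have h1 : Tendsto (fun T => beatonPP (T + 1)) atTop (𝓝 0) := h.comp (tendsto_add_atTop_nat 1)
  have h2 : Tendsto (fun T => beatonPP (T + 2)) atTop (𝓝 0) := h.comp (tendsto_add_atTop_nat 2)
  have hup : Tendsto (fun T => hexConnectiveConstant * beatonPP (T + 1) + hexConnectiveConstant ^ 2 * beatonPP (T + 2))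
      atTop (𝓝 0) := by
    have := (h1.const_mul hexConnectiveConstant).add (h2.const_mul (hexConnectiveConstant ^ 2))
    simpa using this
  exact tendsto_of_tendsto_of_tendsto_of_le_of_le tendsto_const_nhds hup bwSpanV_nonneg bwSpanV_le_beatonPP

/-- **Infinite mean SPAN of the critical irreducible brick-wall bridges** (Beaton's "`E_iSAPP(H(γ)) = ∞`" in the tree's
frame), conditional on Theorem 14: the span renewal sequence (`v_0 = 1`, `0 ≤ v_T ≤ 1`, `v_T = Σ f_k v_{T-k}`, `Σ f_T = 1`)
with `v_T → 0` is null recurrent (Feller XIII.4; tree `Renewal.not_summable_mul_of_tendsto_zero`, as in the parallel-frame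
`HV.not_summable_width_mul_stripIlim`). [cite: Beaton2014RotatedHoneycomb, Appendix, Lemma 16 (arXiv v3 p. 20); Feller1968, XIII.3–XIII.4] -/
theorem not_summable_mul_bwSpanF_of_beaton (h : Beaton2014Thm14) : ¬ Summable fun T : ℕ => (T : ℝ) * bwSpanF T :=
  _root_.Literature.Probability.Process.Renewal.not_summable_mul_of_tendsto_zero (u := bwSpanV) (f := bwSpanF)
    bwSpanV_zero bwSpanV_nonneg bwSpanV_le_one bwSpanF_nonneg bwSpanF_zero (fun _ hT => bwSpanV_eq_sum hT)
    hasSum_bwSpanF (tendsto_bwSpanV_zero_of_beaton h)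

/-- **K93.0 — infinite mean LENGTH of the critical irreducible brick-wall bridges**, conditional on Theorem 14:
`¬ Summable (k ↦ k · λ_k(ℍ) μ_ℍ^{-k})` (span ≤ length, `summable_mul_bwSpanF_of_summable` contrapositively).
[cite: Beaton2014RotatedHoneycomb, Appendix, Lemma 16 (arXiv v3 p. 20); MadrasSlade1993, §4.2, Theorem 4.2.2 (b)] -/
theorem not_summable_mul_irreducibleBridgeCount_of_beaton (h : Beaton2014Thm14) :
    ¬ Summable fun k : ℕ => (k : ℝ) * ((irreducibleBridgeCount k : ℝ) / hexConnectiveConstant ^ k) :=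
  fun hs => not_summable_mul_bwSpanF_of_beaton h (summable_mul_bwSpanF_of_summable hs)

/-- **Door R93 (a): `b_n(ℍ) μ_ℍ^{-n} → 0` for the brick-wall bridges of the hexagonal lattice (bridges crossing ℍ
perpendicularly to an edge class), CONDITIONAL on Beaton's Theorem 14.**  Closes the open face of door R87b
(`HexBW.exists_tendsto_bridgeCount_div_pow`: "Whether `L = 0` in this frame is not decided here") modulo one printed,
proved theorem: Theorem 14 ⇒ `v_T → 0` (sandwich) ⇒ null recurrence of the span renewal ⇒ infinite mean length of the
critical irreducible bridges ⇒ (`tendsto_bridgeCount_div_pow_zero_of_not_summable`, renewal theorem) `L = 0`.  Not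
stated in print in this frame; the parallel (Duminil-Copin–Smirnov strip) frame is `SAW.hexBridgeLengthNull`.
[cite: Beaton2014RotatedHoneycomb, Appendix, Theorem 14 (arXiv v3 p. 19) and Lemma 16 (arXiv v3 p. 20); MadrasSlade1993, Theorem 4.2.2 (b) (p. 91) and p. 92] -/
theorem tendsto_bridgeCount_div_pow_zero_of_beaton (h : Beaton2014Thm14) :
    Tendsto (fun n : ℕ => (bridgeCount n : ℝ) / hexConnectiveConstant ^ n) atTop (𝓝 0) :=
  tendsto_bridgeCount_div_pow_zero_of_not_summable (not_summable_mul_irreducibleBridgeCount_of_beaton h)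

/-! ### Beaton's Lemma 16 in the kernel: Theorem 14 ⟺ `v_T → 0` ⟺ infinite mean span (unconditional equivalences) -/

/-- `f_1 > 0`: the one-step horizontal bridge is irreducible of span `1` (aperiodicity of the span renewal).
[cite: MadrasSlade1993, §4.2, Definition 4.2.1] -/
theorem bwSpanF_one_pos : 0 < bwSpanF 1 := by
  have hμ : 0 < hexConnectiveConstant := hexConnectiveConstant_pos
  have hmem : Zd.straightWalk 2 1 ∈ spanIrreducibleBridges 1 1 := by
    refine mem_spanIrreducibleBridges.2 ⟨mem_irreducibleBridges.2 ⟨straightWalk_mem_bridges 1, le_rfl,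
      (mem_bridges.1 (straightWalk_mem_bridges 1)).2, fun k h1 h2 => by omega⟩, ?_⟩
    simp [Zd.straightWalk]
  have h1 : (1 : ℝ) ≤ #(spanIrreducibleBridges 1 1) := by
    exact_mod_cast Finset.card_pos.2 ⟨_, hmem⟩
  have h2 : bwIrrSpanTerm 1 1 ≤ bwSpanF 1 :=
    (summable_bwIrrSpanTerm 1).le_tsum 1 fun m _ => bwIrrSpanTerm_nonneg 1 m
  have h3 : 0 < bwIrrSpanTerm 1 1 := by
    unfold bwIrrSpanTerm
    exact div_pos (by linarith) (pow_pos hμ 1)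
  linarith

/-- **`v_T → 0` iff the critical irreducible brick-wall bridges have infinite mean span** (Feller: null recurrence
criterion one way, the renewal theorem `u_n → 1/mean` resp. `→ 0` the other way; aperiodicity from `f_1 > 0`).
[cite: Beaton2014RotatedHoneycomb, Appendix, Lemma 16 (arXiv v3 p. 20); Feller1968, XIII.3–XIII.4; MadrasSlade1993, Theorem 4.2.2 (b)] -/
theorem tendsto_bwSpanV_zero_iff_not_summable :
    Tendsto bwSpanV atTop (𝓝 0) ↔ ¬ Summable fun T : ℕ => (T : ℝ) * bwSpanF T := by
  constructor
  · intro h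
    exact _root_.Literature.Probability.Process.Renewal.not_summable_mul_of_tendsto_zero (u := bwSpanV) (f := bwSpanF)
      bwSpanV_zero bwSpanV_nonneg bwSpanV_le_one bwSpanF_nonneg bwSpanF_zero (fun _ hT => bwSpanV_eq_sum hT)
      hasSum_bwSpanF h
  · intro h
    exact _root_.Literature.Probability.Process.Renewal.tendsto_zero_of_not_summable_mul (u := bwSpanV) (f := bwSpanF)
      bwSpanV_zero bwSpanV_nonneg bwSpanV_le_one bwSpanF_nonneg bwSpanF_zero (fun _ hT => bwSpanV_eq_sum hT)
      hasSum_bwSpanF bwSpanF_one_pos h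

/-- **Theorem 14 ⟺ `v_T → 0`** (the sandwich `PP_T ≤ v_T ≤ μ PP_{T+1} + μ² PP_{T+2}`): Beaton's height-`T` generating
functions and the tree's span-`T` generating functions vanish in the limit together — so the named fact is EQUIVALENT to a
statement about the tree's own brick-wall bridges. [cite: Beaton2014RotatedHoneycomb, Appendix, Theorem 14 and Corollary 15 (arXiv v3 p. 19)] -/
theorem beaton2014Thm14_iff_tendsto_bwSpanV_zero : Beaton2014Thm14 ↔ Tendsto bwSpanV atTop (𝓝 0) := by
  refine ⟨tendsto_bwSpanV_zero_of_beaton, fun h => ?_⟩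
  exact tendsto_of_tendsto_of_tendsto_of_le_of_le tendsto_const_nhds h beatonPP_nonneg beatonPP_le_bwSpanV

/-- **Beaton's Lemma 16 in the kernel**: "Thus Theorem 14 is equivalent to `E_iSAPP(H(γ)) = ∞`" — in brick-wall dress,
`Beaton2014Thm14 ↔ ¬ Summable (T ↦ T · f_T)` (infinite mean SPAN of the critical irreducible brick-wall bridges of the
tree).  Unconditional; it identifies exactly what the named fact asserts about tree objects.
[cite: Beaton2014RotatedHoneycomb, Appendix, Lemma 16 (arXiv v3 p. 20)] -/
theorem beaton2014Thm14_iff_not_summable :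
    Beaton2014Thm14 ↔ ¬ Summable fun T : ℕ => (T : ℝ) * bwSpanF T :=
  beaton2014Thm14_iff_tendsto_bwSpanV_zero.trans tendsto_bwSpanV_zero_iff_not_summable

end HexBW

end Literature.Probability.RandomPlanarGeometry.SAW
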